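import Summits.Ventures.Crystal3D.Theorems.StickyWulffConstantNoReconstructionGainGrainCount
import HarnessLib

/-!
# At most `k` band elements per segment (shallow transport families)

HONEST FRAMING. Part of the venture `Summits/Ventures/Crystal3D` (cell `crystal3d-full`), helper
`--supports` the crux `NoReconstructionGain` (stmt-Ventures-19144, route
`route-Ventures-StickyWulffConstant`), line `adhesion`, grain rungs.  Abstract bookkeeping only
(no geometry), the `k`-fold version of `…GrainCount`: it is the brick the `(100)`-facet grain
rung needs, where some transport families climb by less than the toucher band per step
(feasibility analysis in the crux evidence RUNG-GRAIN.md: integer credits fail at `(100)`,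
fractional credits `1/k` suffice).

`T` an injective self-map raising a height `ht` by at least `δ` per step; `Q` finite;
`B ⊆ Q` a set of "band elements" whose heights lie in a window `[a, a + kδ)` and which is closed
under taking `T`-predecessors inside `Q` (below the band is forbidden).  Then every element of
`B` is `T^[i] s` for a segment bottom `s` (an element of `Q` without predecessor in `Q`) and some
`i < k`, so `#B ≤ k · #{q ∈ Q : T q ∉ Q}` (`card_band_le_mul_seg`).  The two-sided version
`card_band_add_le_mul_seg` counts a high band (predecessor-closed, heights `≥ m`) and a low band
(successor-closed, heights `< m`) by distinct segments: `#Ba + #Bb ≤ k · #{q ∈ Q : T q ∉ Q}`.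
For `k = 1` these are the lemmas of `…GrainCount`.

WHAT THIS IS NOT: anything about packings; rung F-C1 not moved.
-/

namespace Summit.Ventures.Crystal3D.Theorems

open Finset

variable {ι : Type*} [DecidableEq ι]

/-- **Descent to a segment bottom.**  `T` raising `ht` by `≥ δ`; `B ⊆ Q` closed
under `Q`-predecessors with heights in `[a, a + kδ)`.  Every `b ∈ B` is `T^[i] s` with `i < k` and
`s ∈ Q` having no `T`-predecessor in `Q`. -/
theorem exists_bottom_of_band (Q : Finset ι) (T : ι → ι) (ht : ι → ℝ) (δ : ℝ)
    (hmono : ∀ x, ht x + δ ≤ ht (T x)) (B : Finset ι) (hBQ : B ⊆ Q) (a : ℝ) (k : ℕ)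
    (hband : ∀ b ∈ B, a ≤ ht b ∧ ht b < a + k * δ)
    (hclosed : ∀ b ∈ B, ∀ p ∈ Q, T p = b → p ∈ B) :
    ∀ b ∈ B, ∃ i, i < k ∧ ∃ s ∈ Q.filter (fun q => q ∉ Q.image T), T^[i] s = b := by
  -- induction on the height level
  have key : ∀ n : ℕ, ∀ b ∈ B, ht b < a + (n + 1) * δ →
      ∃ i, i ≤ n ∧ ∃ s ∈ Q.filter (fun q => q ∉ Q.image T), T^[i] s = b := by
    intro n
    induction n with
    | zero =>
      intro b hb hlt
      refine ⟨0, le_rfl, b, ?_, rfl⟩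
      rw [mem_filter]
      refine ⟨hBQ hb, fun himg => ?_⟩
      obtain ⟨p, hp, hpb⟩ := mem_image.1 himg
      have hpB := hclosed b hb p hp hpb
      have h1 := (hband p hpB).1
      have h2 := hmono p
      rw [hpb] at h2
      push_cast at hlt
      linarith
    | succ n ih =>
      intro b hb hlt
      by_cases hpred : b ∈ Q.image T
      · obtain ⟨p, hp, hpb⟩ := mem_image.1 hpred
        have hpB := hclosed b hb p hp hpb
        have h2 := hmono p
        rw [hpb] at h2
        have hlt' : ht p < a + (n + 1) * δ := by push_cast at hlt ⊢; linarith
        obtain ⟨i, hi, s, hs, hsi⟩ := ih p hpB hlt'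
        refine ⟨i + 1, by omega, s, hs, ?_⟩
        rw [Function.iterate_succ_apply', hsi, hpb]
      · exact ⟨0, Nat.zero_le _, b, mem_filter.2 ⟨hBQ hb, hpred⟩, rfl⟩
  intro b hb
  rcases Nat.eq_zero_or_pos k with hk | hk
  · exfalso
    have h := hband b hb
    rw [hk] at h
    push_cast at h
    linarith [h.1, h.2]
  · obtain ⟨i, hi, s, hs, hsi⟩ := key (k - 1) b hb (by
      have h := (hband b hb).2
      have e : ((k - 1 : ℕ) : ℝ) + 1 = (k : ℝ) := by
        rw [Nat.cast_sub hk]; push_cast; ring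
      rw [e]; exact h)
    exact ⟨i, by omega, s, hs, hsi⟩

/-- **At most `k` band elements per segment.**  Under the hypotheses of `exists_bottom_of_band`,
`#B ≤ k · #{q ∈ Q : T q ∉ Q}`. -/
theorem card_band_le_mul_seg (Q : Finset ι) (T : ι → ι) (hT : Function.Injective T)
    (ht : ι → ℝ) (δ : ℝ) (hmono : ∀ x, ht x + δ ≤ ht (T x))
    (B : Finset ι) (hBQ : B ⊆ Q) (a : ℝ) (k : ℕ)
    (hband : ∀ b ∈ B, a ≤ ht b ∧ ht b < a + k * δ)
    (hclosed : ∀ b ∈ B, ∀ p ∈ Q, T p = b → p ∈ B) :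
    B.card ≤ k * (Q.filter fun q => T q ∉ Q).card := by
  set S := Q.filter (fun q => q ∉ Q.image T) with hS
  have hcover : B ⊆ (range k).biUnion fun i => S.image (T^[i]) := by
    intro b hb
    obtain ⟨i, hi, s, hs, hsi⟩ :=
      exists_bottom_of_band Q T ht δ hmono B hBQ a k hband hclosed b hb
    rw [mem_biUnion]
    exact ⟨i, mem_range.2 hi, mem_image.2 ⟨s, hs, hsi⟩⟩
  calc B.card ≤ ((range k).biUnion fun i => S.image (T^[i])).card := card_le_card hcover
    _ ≤ ∑ i ∈ range k, (S.image (T^[i])).card := card_biUnion_le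
    _ ≤ ∑ _i ∈ range k, S.card := sum_le_sum fun i _ => card_image_le
    _ = k * S.card := by rw [sum_const, card_range, smul_eq_mul]
    _ = k * (Q.filter fun q => T q ∉ Q).card := by
        rw [hS, ← card_filter_succ_not_mem_eq Q T hT]

/-- **Two-sided version.**  `T` injective raising `ht` by `≥ δ ≥ 0`; `Ba ⊆ Q` predecessor-closed band
elements at heights `≥ m`, `Bb ⊆ Q` successor-closed band elements at heights `< m`, each band of
width `< kδ`.  Then `#Ba + #Bb ≤ k · #{q ∈ Q : T q ∉ Q}` (high and low segments are distinct). -/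
theorem card_band_add_le_mul_seg (Q : Finset ι) (T : ι → ι) (hT : Function.Injective T)
    (ht : ι → ℝ) (δ : ℝ) (hδ : 0 ≤ δ) (hmono : ∀ x, ht x + δ ≤ ht (T x)) (m : ℝ) (k : ℕ)
    (Ba Bb : Finset ι) (hBa : Ba ⊆ Q) (hBb : Bb ⊆ Q)
    (hBa_hi : ∀ q ∈ Ba, m ≤ ht q) (hBb_lo : ∀ q ∈ Bb, ht q < m)
    (a : ℝ) (hband_a : ∀ b ∈ Ba, a ≤ ht b ∧ ht b < a + k * δ)
    (a' : ℝ) (hband_b : ∀ b ∈ Bb, a' ≤ ht b ∧ ht b < a' + k * δ)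
    (hclosed_a : ∀ b ∈ Ba, ∀ p ∈ Q, T p = b → p ∈ Ba)
    (hclosed_b : ∀ b ∈ Bb, T b ∈ Q → T b ∈ Bb) :
    Ba.card + Bb.card ≤ k * (Q.filter fun q => T q ∉ Q).card := by
  set Qhi := Q.filter fun q => m ≤ ht q with hQhi
  set Qlo := Q.filter fun q => ht q < m with hQlo
  -- high part: predecessors of `Ba` inside `Q` are in `Ba ⊆ Qhi`
  have hBaQhi : Ba ⊆ Qhi := fun q hq => by
    rw [hQhi, mem_filter]; exact ⟨hBa hq, hBa_hi q hq⟩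
  have hA := card_band_le_mul_seg Qhi T hT ht δ hmono Ba hBaQhi a k hband_a
    (fun b hb p hp hpb => hclosed_a b hb p (mem_filter.1 hp).1 hpb)
  -- low part: apply the one-sided lemma to the reversed order via `-ht` is not available for a
  -- non-invertible `T`; instead count successor-free elements of `Qlo` directly by ascent.
  have key : ∀ n : ℕ, ∀ b ∈ Bb, a' + k * δ - (n + 1) * δ ≤ ht b →
      ∃ i, i ≤ n ∧ T^[i] b ∈ Qlo ∧ T (T^[i] b) ∉ Q := by
    intro n
    induction n with
    | zero =>
      intro b hb hge
      refine ⟨0, le_rfl, ?_, ?_⟩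
      · rw [hQlo, mem_filter]; exact ⟨hBb hb, hBb_lo b hb⟩
      · intro hTb
        have hTbB := hclosed_b b hb hTb
        have h1 := (hband_b _ hTbB).2
        have h2 := hmono b
        simp only [Function.iterate_zero, id_eq] at *
        push_cast at hge
        linarith
    | succ n ih =>
      intro b hb hge
      by_cases hsucc : T b ∈ Q
      · have hTbB := hclosed_b b hb hsucc
        have h2 := hmono b
        have hge' : a' + k * δ - (n + 1) * δ ≤ ht (T b) := by push_cast at hge ⊢; linarith
        obtain ⟨i, hi, hmem, htop⟩ := ih (T b) hTbB hge'
        refine ⟨i + 1, by omega, ?_, ?_⟩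
        · rw [Function.iterate_succ_apply]; exact hmem
        · rw [Function.iterate_succ_apply]; exact htop
      · refine ⟨0, Nat.zero_le _, ?_, ?_⟩
        · rw [hQlo, mem_filter]; exact ⟨hBb hb, hBb_lo b hb⟩
        · simpa using hsucc
  -- every low band element reaches a successor-free element of `Qlo` in `< k` steps
  have hcoverB : Bb ⊆ (range k).biUnion fun i =>
      (Qlo.filter fun q => T q ∉ Q).preimage (T^[i]) (hT.iterate i).injOn := by
    intro b hb
    rcases Nat.eq_zero_or_pos k with hk | hk
    · exfalso
      have h := hband_b b hb
      rw [hk] at h; push_cast at h; linarith [h.1, h.2]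
    obtain ⟨i, hi, hmem, htop⟩ := key (k - 1) b hb (by
      have h := (hband_b b hb).1
      have e : ((k - 1 : ℕ) : ℝ) + 1 = (k : ℝ) := by
        rw [Nat.cast_sub hk]; push_cast; ring
      rw [e]; linarith)
    rw [mem_biUnion]
    refine ⟨i, mem_range.2 (by omega), ?_⟩
    rw [mem_preimage, mem_filter]
    exact ⟨hmem, htop⟩
  have hB : Bb.card ≤ k * (Qlo.filter fun q => T q ∉ Q).card := by
    calc Bb.card ≤ ((range k).biUnion fun i =>
          (Qlo.filter fun q => T q ∉ Q).preimage (T^[i]) (hT.iterate i).injOn).card :=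
          card_le_card hcoverB
      _ ≤ ∑ i ∈ range k, ((Qlo.filter fun q => T q ∉ Q).preimage (T^[i])
          (hT.iterate i).injOn).card := card_biUnion_le
      _ ≤ ∑ _i ∈ range k, (Qlo.filter fun q => T q ∉ Q).card := by
          refine sum_le_sum fun i _ => ?_
          rw [← card_image_of_injective ((Qlo.filter fun q => T q ∉ Q).preimage (T^[i])
            (hT.iterate i).injOn) (hT.iterate i)]
          refine card_le_card fun y hy => ?_
          obtain ⟨x, hx, rfl⟩ := mem_image.1 hy
          exact mem_preimage.1 hx
      _ = k * (Qlo.filter fun q => T q ∉ Q).card := by rw [sum_const, card_range, smul_eq_mul]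
  -- the high tops (of `Qhi`, counted inside `Qhi`) and the low tops are disjoint tops of `Q`
  have hclosedhi : (Qhi.filter fun q => T q ∉ Qhi) = Qhi.filter fun q => T q ∉ Q := by
    refine filter_congr fun q hq => ?_
    rw [hQhi, mem_filter] at hq ⊢
    constructor
    · intro h hmem; exact h ⟨hmem, le_trans hq.2 (by linarith [hmono q])⟩
    · intro h hmem; exact h hmem.1
  have hsub : (Qhi.filter fun q => T q ∉ Q) ∪ (Qlo.filter fun q => T q ∉ Q) ⊆
      Q.filter fun q => T q ∉ Q := by
    intro q hq
    rw [mem_filter]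
    rcases mem_union.1 hq with h | h
    · rw [mem_filter, hQhi, mem_filter] at h; exact ⟨h.1.1, h.2⟩
    · rw [mem_filter, hQlo, mem_filter] at h; exact ⟨h.1.1, h.2⟩
  have hdisj : Disjoint (Qhi.filter fun q => T q ∉ Q) (Qlo.filter fun q => T q ∉ Q) := by
    rw [disjoint_left]
    intro q h1 h2
    rw [mem_filter, hQhi, mem_filter] at h1
    rw [mem_filter, hQlo, mem_filter] at h2
    linarith [h1.1.2, h2.1.2]
  have hA' : Ba.card ≤ k * (Qhi.filter fun q => T q ∉ Q).card := by rw [← hclosedhi]; exact hA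
  calc Ba.card + Bb.card
      ≤ k * (Qhi.filter fun q => T q ∉ Q).card + k * (Qlo.filter fun q => T q ∉ Q).card :=
        Nat.add_le_add hA' hB
    _ = k * ((Qhi.filter fun q => T q ∉ Q) ∪ (Qlo.filter fun q => T q ∉ Q)).card := by
        rw [card_union_of_disjoint hdisj, Nat.mul_add]
    _ ≤ k * (Q.filter fun q => T q ∉ Q).card := Nat.mul_le_mul_left _ (card_le_card hsub)

end Summit.Ventures.Crystal3D.Theorems
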